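import Literature.Computability.Cryptography.RegevSamplerQuery
import Literature.Computability.Cryptography.RegevSamplerIndex
import Literature.Computability.Cryptography.RegevCVPOracleErrFn
import Literature.Algebra.EuclideanLattices.RegevQuantumPartLaw
import HarnessLib

/-!
# Regev 2009, Lemma 3.14 in machine form: the register data of the sampler's classical stage

Topic `Computability/Cryptography` (family `pqc`), grouping namespace `Regev2009.SamplerRegs`; sequel of
`RegevSamplerClassical.lean` (the layout `Λ` of the classical stage on a `W`-wire register: point zone `X`,
input zone `U`, branch zone `Y`, residue zone `S`, answer zone `A`; the label action `kappa Λ f` of the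
stage; `kappa_spec`), `RegevSamplerGeometry.lean` (the QPart data of the sampler in rescaled units) and
`Algebra/EuclideanLattices/RegevQuantumPartStates.lean` (`QPart.RegHyps`: the register hypotheses under
which Regev's Lemma 3.14 law bound `QPart.law_bound_of_basis` holds). Regev (J. ACM 56 (2009), art. 34,
proof of Lemma 3.14): "we can now apply the quantum Fourier transform … to the second register" — the
second register being the residues `s ∈ ℤ_Rⁿ` left CLEAN after the first register was uncomputed with
the `CVP` oracle. This file names the concrete register data of that picture for the layout `Λ`:

* `Sblk Λ hΛ i` — the `i`-th residue block (`ℓR` wires of the zone `S`), `sblk_disjoint`;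
* `enc Λ r` — the code of a residue `r ∈ ℤ_{2^{ℓR}}` (its `ℓR`-bit numeral, most significant bit first —
  the format of the query table `CVPOracle.table`), `valBE_enc` (`QPart.valBE (enc r) = r.val`);
* `ytilOf`, `blocksOf` — the integer branch vector named by a branch point and the block contents of a box
  point (`ytilOf_smul_gridPt`, `blocksOf_boxPt`);
* `lab₀ … x` — the prepared label of the box point `x` (point bits on `X`, the input-zone content `uz` on
  `U`, zeros elsewhere) and `base … y` — the clean content of the branch `y` (the branch table on `Y`, `uz`
  on `U`, zeros elsewhere), with their evaluation lemmas, `lab₀_injOn`, `base_sep`.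

Everything is proved; definitions have bodies; no named fact is introduced.

## References

* O. Regev, *On lattices, learning with errors, random linear codes, and cryptography*, J. ACM 56
  (2009), art. 34; author's version arXiv:2401.03703: Lemma 3.14 (proof), p. 20 [Regev2009].
* M. A. Nielsen, I. L. Chuang, *Quantum Computation and Quantum Information*, CUP 2010, §3.2.5
  (uncomputation), §5.1 (register numerals) [NielsenChuang2010].
-/

noncomputable section

namespace Literature.Computability.Cryptography

namespace Regev2009

namespace SamplerRegs

open Literature.Algebra.EuclideanLattices Literature.Algebra.EuclideanLattices.Regev2009
  Literature.Algebra.EuclideanLattices.Regev2009.QPart Literature.Computability.QuantumComplexity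
  Literature.Computability.QuantumComplexity.GaussianCells Literature.Computability.QuantumComplexity.QFTQubits
  Literature.Computability.Complexity Literature.LinearAlgebra.Matrix.Berkowitz Peikert2009 Finset SamplerArith
  SamplerScale SamplerGeom SamplerWords SamplerWordFns SamplerFormats SamplerQuery CVPOracle SamplerClassical
  SamplerClassical.Layout _root_.Computability
open scoped InnerProductSpace

variable {W : ℕ} (I : LatticeInstance) (Λ : Layout W I.n)

/-! ### Block index arithmetic -/

omit Λ in
/-- `i·ℓ + j < n·ℓ` for `i < n`, `j < ℓ`. [folklore] -/
theorem blk_lt {n ℓ : ℕ} (i : Fin n) (j : Fin ℓ) : (i : ℕ) * ℓ + j < n * ℓ :=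
  calc (i : ℕ) * ℓ + j < (i : ℕ) * ℓ + ℓ := Nat.add_lt_add_left j.2 _
    _ = ((i : ℕ) + 1) * ℓ := (Nat.succ_mul _ _).symm
    _ ≤ n * ℓ := Nat.mul_le_mul_right _ i.2

omit Λ in
/-- Block coordinates are determined by the flat index. [folklore] -/
theorem blk_inj {n ℓ : ℕ} {i i' : Fin n} {j j' : Fin ℓ} (h : (i : ℕ) * ℓ + j = (i' : ℕ) * ℓ + j') : i = i' ∧ j = j' := by
  have hℓ : 0 < ℓ := Nat.pos_of_ne_zero fun h0 => absurd j.2 (by omega)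
  have hi : (i : ℕ) = i' := by
    have e1 : ((i : ℕ) * ℓ + j) / ℓ = i := by rw [Nat.mul_comm, Nat.mul_add_div hℓ, Nat.div_eq_of_lt j.2, Nat.add_zero]
    have e2 : ((i' : ℕ) * ℓ + j') / ℓ = i' := by rw [Nat.mul_comm, Nat.mul_add_div hℓ, Nat.div_eq_of_lt j'.2, Nat.add_zero]
    rw [← e1, ← e2, h]
  refine ⟨Fin.ext hi, Fin.ext ?_⟩
  rw [hi] at h
  omega

/-- Offsets, unfolded. [folklore] -/
theorem offs_eq : Λ.oU = I.n * Λ.ℓ ∧ Λ.oY = I.n * Λ.ℓ + Λ.L ∧ Λ.oS = I.n * Λ.ℓ + Λ.L + I.n * Λ.ℓY ∧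
    Λ.oA = I.n * Λ.ℓ + Λ.L + I.n * Λ.ℓY + I.n * Λ.ℓR ∧ Λ.T = I.n * Λ.ℓ + Λ.L + I.n * Λ.ℓY + I.n * Λ.ℓR + I.n * Λ.bc :=
  ⟨rfl, rfl, rfl, rfl, rfl⟩

/-! ### The residue blocks -/

variable {Λ} (hΛ : Λ.OK)

/-- **The `i`-th residue block**: wires `S[i·ℓR, (i+1)·ℓR)`. [cite: Regev2009, Lemma 3.14 (proof: "the second register")] -/
def Sblk (i : Fin I.n) : Fin Λ.ℓR ↪ Fin W :=
  ⟨fun j => Λ.fin (Λ.oS + ((i : ℕ) * Λ.ℓR + j)), fun j j' h => by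
    have hj := blk_lt i j
    have hj' := blk_lt i j'
    have hT := Λ.T_eq
    obtain ⟨hU', hY', hS', hA', -⟩ := offs_eq I Λ
    have := Layout.fin_inj hΛ (by omega) (by omega) h
    exact Fin.ext (by omega)⟩

/-- Its wires. [folklore] -/
theorem sblk_apply (i : Fin I.n) (j : Fin Λ.ℓR) : Sblk I hΛ i j = Λ.fin (Λ.oS + ((i : ℕ) * Λ.ℓR + j)) := rfl

/-- **The residue blocks are pairwise disjoint** (the `hdis` register hypothesis). [folklore] -/
theorem sblk_disjoint (i i' : Fin I.n) (h : i ≠ i') : Disjoint (Set.range (Sblk I hΛ i)) (Set.range (Sblk I hΛ i')) := by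
  refine Set.disjoint_left.2 ?_
  rintro _ ⟨j, rfl⟩ ⟨j', hj'⟩
  rw [sblk_apply, sblk_apply] at hj'
  have h1 := blk_lt i j
  have h2 := blk_lt i' j'
  have hT := Λ.T_eq
  obtain ⟨hU', hY', hS', hA', -⟩ := offs_eq I Λ
  have h3 := Layout.fin_inj hΛ (by omega) (by omega) hj'
  have h4 : (i' : ℕ) * Λ.ℓR + j' = (i : ℕ) * Λ.ℓR + j := by omega
  exact h (blk_inj h4).1.symm

/-- A residue-block wire is the zone wire of an index in `[oS, oA)`. [folklore] -/
theorem sblk_index (i : Fin I.n) (j : Fin Λ.ℓR) :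
    ∃ s, s < I.n * Λ.ℓR ∧ Sblk I hΛ i j = Λ.fin (Λ.oS + s) :=
  ⟨_, blk_lt i j, rfl⟩

/-! ### The code of a residue -/

/-- **The code of a residue** `r ∈ ℤ_{2^{ℓR}}`: its `ℓR`-bit numeral, most significant bit first (the
format of `CVPOracle.table`). [cite: Regev2009, Lemma 3.14 (proof: "a state on n log R qubits")] -/
def enc (Λ : Layout W I.n) (r : ZMod (2 ^ Λ.ℓR)) : Fin Λ.ℓR → Bool := fun j => r.val.testBit (Λ.ℓR - 1 - j)

omit hΛ in
/-- **The numeral reads the code back**: `valBE (enc r) = r` (the `enc_val` register hypothesis).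
[cite: NielsenChuang2010, §5.1] -/
theorem valBE_enc (r : ZMod (2 ^ Λ.ℓR)) : valBE (enc I Λ r) = r.val := by
  unfold valBE enc
  have h1 : (∑ j : Fin Λ.ℓR, if r.val.testBit (Λ.ℓR - 1 - j) then 2 ^ (Λ.ℓR - 1 - (j : ℕ)) else 0) =
      ∑ i : Fin Λ.ℓR, if r.val.testBit i then 2 ^ (i : ℕ) else 0 := by
    refine Fintype.sum_equiv Fin.revPerm _ _ fun j => ?_
    rw [Fin.revPerm_apply, Fin.val_rev, show Λ.ℓR - 1 - (j : ℕ) = Λ.ℓR - ((j : ℕ) + 1) by omega]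
  rw [h1, show (∑ i : Fin Λ.ℓR, if r.val.testBit i then 2 ^ (i : ℕ) else 0) = tVal fun i : Fin Λ.ℓR => r.val.testBit i from rfl,
    tVal_eq_ofBits, Nat.ofBits_testBit, Nat.mod_eq_of_lt (ZMod.val_lt r)]

omit hΛ in
/-- The code of a natural residue `s < 2^{ℓR}` is its numeral `bitsMSB`. [folklore] -/
theorem ofFn_enc_natCast {s : ℕ} (hs : s < 2 ^ Λ.ℓR) : List.ofFn (enc I Λ (s : ZMod (2 ^ Λ.ℓR))) = bitsMSB Λ.ℓR s := by
  unfold enc bitsMSB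
  rw [ZMod.val_natCast, Nat.mod_eq_of_lt hs]

/-! ### Branch vectors and block contents named by points -/

variable (R : ℕ) (t : ℝ)

omit hΛ in
/-- **The integer branch vector named by a branch point**: `ỹᵢ = round((R|det B|/t)·yᵢ)`. [folklore] -/
def ytilOf (y : EuclideanSpace ℝ (Fin I.n)) : Fin I.n → ℤ := fun i => round (DT I R t * y i)

omit hΛ in
/-- On `t • gridPt u` it returns `u`. [folklore] -/
theorem ytilOf_smul_gridPt [IsZLattice ℝ I.lattice] [NeZero R] (ht : t ≠ 0) (u : Fin I.n → ℤ) : ytilOf I R t (t • gridPt I R u) = u := by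
  funext i
  unfold ytilOf
  have hD : (Dg I R : ℝ) ≠ 0 := by
    have := detA_ne_zero (I := I); have := NeZero.ne R; unfold Dg; exact_mod_cast Nat.mul_ne_zero ‹_› ‹_›
  rw [PiLp.smul_apply, gridPt, PiLp.smul_apply, intVecToEuclidean_apply, smul_eq_mul, smul_eq_mul, DT,
    show (Dg I R : ℝ) / t * (t * ((Dg I R : ℝ)⁻¹ * (u i : ℝ))) = u i by field_simp, round_intCast]

omit hΛ in
/-- **The block contents of a box point** (junk off the box). [folklore] -/
def blocksOf (ℓ : ℕ) (D : ℝ) (x : EuclideanSpace ℝ (Fin I.n)) : Fin I.n → Fin ℓ → Bool :=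
  if h : ∃ Yb : Fin I.n → Fin ℓ → Bool, boxPt D Yb = x then h.choose else fun _ _ => false

omit hΛ in
/-- On a box point they are its blocks. [folklore] -/
theorem blocksOf_boxPt {ℓ : ℕ} {D : ℝ} (hD : D ≠ 0) (Yb : Fin I.n → Fin ℓ → Bool) : blocksOf I ℓ D (boxPt D Yb) = Yb := by
  unfold blocksOf
  have h : ∃ Yb' : Fin I.n → Fin ℓ → Bool, boxPt D Yb' = boxPt D Yb := ⟨Yb, rfl⟩
  rw [dif_pos h]
  exact boxPt_injective hD h.choose_spec

omit hΛ in
/-- A box point is the point of its blocks. [folklore] -/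
theorem boxPt_blocksOf {ℓ : ℕ} {D : ℝ} {x : EuclideanSpace ℝ (Fin I.n)} (hx : x ∈ boxSet I.n ℓ D) :
    boxPt D (blocksOf I ℓ D x) = x := by
  obtain ⟨Yb, -, rfl⟩ := mem_image.1 hx
  unfold blocksOf
  have h : ∃ Yb' : Fin I.n → Fin ℓ → Bool, boxPt D Yb' = boxPt D Yb := ⟨Yb, rfl⟩
  rw [dif_pos h]
  exact h.choose_spec

/-! ### The prepared label and the clean branch content -/

variable (uz : List Bool)

/-- **The prepared label of a box point `x`**: its point bits `pointsWord` on the zone `X`, the input-zone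
content `uz` on `U`, zeros on `Y`, `S`, `A` and everywhere else. [cite: Regev2009, Lemma 3.14 (proof: the registers)] -/
def lab₀ (Λ : Layout W I.n) (R : ℕ) (t : ℝ) (uz : List Bool) (x : EuclideanSpace ℝ (Fin I.n)) : QReg W := fun w =>
  if h : ∃ s : Fin (I.n * Λ.ℓ), w = Λ.fin s then (pointsWord (blocksOf I Λ.ℓ (DT I R t) x)).getD h.choose false
  else if h : ∃ s : Fin Λ.L, w = Λ.fin (Λ.oU + s) then uz.getD h.choose false else false

/-- **The clean content of the branch `y`**: the branch table `tableZ ℓY (ỹ)` on the zone `Y`, the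
input-zone content `uz` on `U`, zeros on `X`, `S`, `A` and everywhere else. [cite: Regev2009, Lemma 3.14 (proof: the registers after the uncomputation)] -/
def base (Λ : Layout W I.n) (R : ℕ) (t : ℝ) (uz : List Bool) (y : EuclideanSpace ℝ (Fin I.n)) : QReg W := fun w =>
  if h : ∃ s : Fin (I.n * Λ.ℓY), w = Λ.fin (Λ.oY + s) then (tableZ Λ.ℓY (ytilOf I R t y)).getD h.choose false
  else if h : ∃ s : Fin Λ.L, w = Λ.fin (Λ.oU + s) then uz.getD h.choose false else false

include hΛ

/-- `lab₀` on the point zone. [folklore] -/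
theorem lab₀_X (x : EuclideanSpace ℝ (Fin I.n)) {s : ℕ} (hs : s < I.n * Λ.ℓ) :
    lab₀ I Λ R t uz x (Λ.fin s) = (pointsWord (blocksOf I Λ.ℓ (DT I R t) x)).getD s false := by
  unfold lab₀
  have h : ∃ s' : Fin (I.n * Λ.ℓ), Λ.fin s = Λ.fin s' := ⟨⟨s, hs⟩, rfl⟩
  rw [dif_pos h]
  have hT := Λ.T_eq
  obtain ⟨hU', hY', hS', hA', -⟩ := offs_eq I Λ
  have := Layout.fin_inj hΛ (by omega) (by have := h.choose.2; omega) h.choose_spec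
  rw [← this]

/-- `lab₀` on the input zone. [folklore] -/
theorem lab₀_U (x : EuclideanSpace ℝ (Fin I.n)) {s : ℕ} (hs : s < Λ.L) :
    lab₀ I Λ R t uz x (Λ.fin (Λ.oU + s)) = uz.getD s false := by
  unfold lab₀
  have hT := Λ.T_eq
  obtain ⟨hU', hY', hS', hA', -⟩ := offs_eq I Λ
  have h1 : ¬ ∃ s' : Fin (I.n * Λ.ℓ), Λ.fin (Λ.oU + s) = Λ.fin s' := by
    rintro ⟨s', hs'⟩
    have := Layout.fin_inj hΛ (by omega) (by have := s'.2; omega) hs'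
    have := s'.2; omega
  have h2 : ∃ s' : Fin Λ.L, Λ.fin (Λ.oU + s) = Λ.fin (Λ.oU + s') := ⟨⟨s, hs⟩, rfl⟩
  rw [dif_neg h1, dif_pos h2]
  have := Layout.fin_inj hΛ (by omega) (by have := h2.choose.2; omega) h2.choose_spec
  rw [show (h2.choose : ℕ) = s by omega]

omit hΛ in
/-- `lab₀` off the point and input zones. [folklore] -/
theorem lab₀_off (x : EuclideanSpace ℝ (Fin I.n)) (w : Fin W) (hX : ∀ s, s < I.n * Λ.ℓ → w ≠ Λ.fin s)
    (hU : ∀ s, s < Λ.L → w ≠ Λ.fin (Λ.oU + s)) : lab₀ I Λ R t uz x w = false := by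
  unfold lab₀
  rw [dif_neg (fun ⟨s, hs⟩ => hX s s.2 hs), dif_neg (fun ⟨s, hs⟩ => hU s s.2 hs)]

/-- `lab₀` vanishes on the zones `Y`, `S`, `A`. [folklore] -/
theorem lab₀_R (x : EuclideanSpace ℝ (Fin I.n)) {s : ℕ} (hs : Λ.oY ≤ s) (hs' : s < Λ.T) : lab₀ I Λ R t uz x (Λ.fin s) = false := by
  have hT := Λ.T_eq
  obtain ⟨hU', hY', hS', hA', -⟩ := offs_eq I Λ
  refine lab₀_off I R t uz x _ (fun s' hs'' h => ?_) (fun s' hs'' h => ?_)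
  · have := Layout.fin_inj hΛ hs' (by omega) h; omega
  · have := Layout.fin_inj hΛ hs' (by omega) h; omega

/-- `lab₀` vanishes at and above the base of the work window. [folklore] -/
theorem lab₀_window (x : EuclideanSpace ℝ (Fin I.n)) (w : Fin W) (hw : Λ.base ≤ (w : ℕ)) : lab₀ I Λ R t uz x w = false := by
  have hT := Λ.T_eq
  obtain ⟨hU', hY', hS', hA', -⟩ := offs_eq I Λ
  refine lab₀_off I R t uz x w (fun s hs h => ?_) (fun s hs h => ?_)
  · have := Layout.fin_lt_base hΛ (i := s) (by omega); rw [← h] at this; omega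
  · have := Layout.fin_lt_base hΛ (i := Λ.oU + s) (by omega); rw [← h] at this; omega

/-- `base` on the branch zone. [folklore] -/
theorem base_Y (y : EuclideanSpace ℝ (Fin I.n)) {s : ℕ} (hs : s < I.n * Λ.ℓY) :
    base I Λ R t uz y (Λ.fin (Λ.oY + s)) = (tableZ Λ.ℓY (ytilOf I R t y)).getD s false := by
  unfold base
  have h : ∃ s' : Fin (I.n * Λ.ℓY), Λ.fin (Λ.oY + s) = Λ.fin (Λ.oY + s') := ⟨⟨s, hs⟩, rfl⟩
  rw [dif_pos h]
  have hT := Λ.T_eq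
  obtain ⟨hU', hY', hS', hA', -⟩ := offs_eq I Λ
  have := Layout.fin_inj hΛ (by omega) (by have := h.choose.2; omega) h.choose_spec
  rw [show (h.choose : ℕ) = s by omega]

/-- `base` on the input zone. [folklore] -/
theorem base_U (y : EuclideanSpace ℝ (Fin I.n)) {s : ℕ} (hs : s < Λ.L) :
    base I Λ R t uz y (Λ.fin (Λ.oU + s)) = uz.getD s false := by
  unfold base
  have hT := Λ.T_eq
  obtain ⟨hU', hY', hS', hA', -⟩ := offs_eq I Λ
  have h1 : ¬ ∃ s' : Fin (I.n * Λ.ℓY), Λ.fin (Λ.oU + s) = Λ.fin (Λ.oY + s') := by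
    rintro ⟨s', hs'⟩
    have := Layout.fin_inj hΛ (by omega) (by have := s'.2; omega) hs'
    omega
  have h2 : ∃ s' : Fin Λ.L, Λ.fin (Λ.oU + s) = Λ.fin (Λ.oU + s') := ⟨⟨s, hs⟩, rfl⟩
  rw [dif_neg h1, dif_pos h2]
  have := Layout.fin_inj hΛ (by omega) (by have := h2.choose.2; omega) h2.choose_spec
  rw [show (h2.choose : ℕ) = s by omega]

omit hΛ in
/-- `base` off the branch and input zones. [folklore] -/
theorem base_off (y : EuclideanSpace ℝ (Fin I.n)) (w : Fin W) (hY : ∀ s, s < I.n * Λ.ℓY → w ≠ Λ.fin (Λ.oY + s))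
    (hU : ∀ s, s < Λ.L → w ≠ Λ.fin (Λ.oU + s)) : base I Λ R t uz y w = false := by
  unfold base
  rw [dif_neg (fun ⟨s, hs⟩ => hY s s.2 hs), dif_neg (fun ⟨s, hs⟩ => hU s s.2 hs)]

/-- `base` vanishes on the point zone. [folklore] -/
theorem base_X (y : EuclideanSpace ℝ (Fin I.n)) {s : ℕ} (hs : s < I.n * Λ.ℓ) : base I Λ R t uz y (Λ.fin s) = false := by
  have hT := Λ.T_eq
  obtain ⟨hU', hY', hS', hA', -⟩ := offs_eq I Λ
  refine base_off I R t uz y _ (fun s' hs' h => ?_) (fun s' hs' h => ?_)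
  · have := Layout.fin_inj hΛ (by omega) (by omega) h; omega
  · have := Layout.fin_inj hΛ (by omega) (by omega) h; omega

/-- `base` vanishes on the zones `S` and `A`. [folklore] -/
theorem base_SA (y : EuclideanSpace ℝ (Fin I.n)) {s : ℕ} (hs : Λ.oS ≤ s) (hs' : s < Λ.T) : base I Λ R t uz y (Λ.fin s) = false := by
  have hT := Λ.T_eq
  obtain ⟨hU', hY', hS', hA', -⟩ := offs_eq I Λ
  refine base_off I R t uz y _ (fun s' hs'' h => ?_) (fun s' hs'' h => ?_)
  · have := Layout.fin_inj hΛ hs' (by omega) h; omega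
  · have := Layout.fin_inj hΛ hs' (by omega) h; omega

/-! ### Injectivity of the prepared labels; separation of the branch contents -/

omit hΛ in
/-- `pointsWord` is injective. [folklore] -/
theorem pointsWord_injective {ℓ : ℕ} : Function.Injective (pointsWord : (Fin I.n → Fin ℓ → Bool) → List Bool) := fun Y Y' h => by
  have h1 := congrArg (readZ ℓ I.n) h
  rw [readZ_pointsWord, readZ_pointsWord] at h1
  funext i
  exact cellPt_injective (by have := congrFun (List.ofFn_injective h1) i; exact this)

/-- **The prepared labels are injective on the box.** [folklore] -/
theorem lab₀_injOn [IsZLattice ℝ I.lattice] [NeZero R] (ht : t ≠ 0) : Set.InjOn (lab₀ I Λ R t uz) (boxSet I.n Λ.ℓ (DT I R t) : Set (EuclideanSpace ℝ (Fin I.n))) := by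
  intro x hx x' hx' h
  have hD : DT I R t ≠ 0 := by
    have := detA_ne_zero (I := I); have := NeZero.ne R; unfold DT Dg
    exact div_ne_zero (by exact_mod_cast Nat.mul_ne_zero ‹_› ‹_›) ht
  rw [← boxPt_blocksOf I (mem_coe.1 hx), ← boxPt_blocksOf I (mem_coe.1 hx')]
  congr 1
  apply pointsWord_injective I
  refine List.ext_getElem? fun s => ?_
  by_cases hs : s < I.n * Λ.ℓ
  · have h1 := congrFun h (Λ.fin s)
    rw [lab₀_X I hΛ R t uz x hs, lab₀_X I hΛ R t uz x' hs, List.getD_eq_getElem _ _ (by rw [length_pointsWord]; exact hs),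
      List.getD_eq_getElem _ _ (by rw [length_pointsWord]; exact hs)] at h1
    rw [List.getElem?_eq_getElem (by rw [length_pointsWord]; exact hs), List.getElem?_eq_getElem (by rw [length_pointsWord]; exact hs), h1]
  · rw [List.getElem?_eq_none (by rw [length_pointsWord]; omega), List.getElem?_eq_none (by rw [length_pointsWord]; omega)]

omit hΛ in
/-- Offset-binary tables are injective on in-range vectors. [folklore] -/
theorem tableZ_injOn {ℓ : ℕ} (hℓ : 1 ≤ ℓ) {c c' : Fin I.n → ℤ} (hc : ∀ i, -2 ^ (ℓ - 1) ≤ c i ∧ c i < 2 ^ (ℓ - 1))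
    (hc' : ∀ i, -2 ^ (ℓ - 1) ≤ c' i ∧ c' i < 2 ^ (ℓ - 1)) (h : tableZ ℓ c = tableZ ℓ c') : c = c' := by
  rw [← tableZL_ofFn, ← tableZL_ofFn] at h
  have e1 : readZ ℓ I.n (tableZL ℓ (List.ofFn c)) = List.ofFn c := by
    have := readZ_tableZL hℓ (c := List.ofFn c) (fun z hz => by obtain ⟨i, rfl⟩ := (List.mem_ofFn' _ _).1 hz; exact hc i)
    rwa [List.length_ofFn] at this
  have e2 : readZ ℓ I.n (tableZL ℓ (List.ofFn c')) = List.ofFn c' := by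
    have := readZ_tableZL hℓ (c := List.ofFn c') (fun z hz => by obtain ⟨i, rfl⟩ := (List.mem_ofFn' _ _).1 hz; exact hc' i)
    rwa [List.length_ofFn] at this
  exact List.ofFn_injective (by rw [← e1, ← e2, h])

omit hΛ in
/-- The length of an offset-binary table. [folklore] -/
theorem length_tableZ {ℓ : ℕ} (c : Fin I.n → ℤ) : (tableZ ℓ c).length = I.n * ℓ := by
  rw [← tableZL_ofFn, length_tableZL, List.length_ofFn]

/-- **Distinct branches are separated off the residue blocks** (the `base_sep` register hypothesis): two
grid branches `t • gridPt u ≠ t • gridPt u'` with `u, u'` in the range of the branch table differ on a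
wire of the zone `Y`. [cite: Regev2009, Lemma 3.14 (proof)] -/
theorem base_sep [IsZLattice ℝ I.lattice] [NeZero R] (ht : t ≠ 0) (hℓY : 1 ≤ Λ.ℓY) {u u' : Fin I.n → ℤ}
    (hu : ∀ i, -2 ^ (Λ.ℓY - 1) ≤ u i ∧ u i < 2 ^ (Λ.ℓY - 1)) (hu' : ∀ i, -2 ^ (Λ.ℓY - 1) ≤ u' i ∧ u' i < 2 ^ (Λ.ℓY - 1))
    (hne : t • gridPt I R u ≠ t • gridPt I R u') :
    ∃ q : Fin W, (∀ i j, Sblk I hΛ i j ≠ q) ∧ base I Λ R t uz (t • gridPt I R u) q ≠ base I Λ R t uz (t • gridPt I R u') q := by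
  have hne' : tableZ Λ.ℓY u ≠ tableZ Λ.ℓY u' := fun h => hne (by rw [tableZ_injOn I hℓY hu hu' h])
  obtain ⟨s, hs, hsne⟩ : ∃ s, s < I.n * Λ.ℓY ∧ (tableZ Λ.ℓY u).getD s false ≠ (tableZ Λ.ℓY u').getD s false := by
    by_contra hall
    apply hne'
    refine List.ext_getElem (by rw [length_tableZ, length_tableZ]) fun s h1 h2 => ?_
    by_contra hs
    refine hall ⟨s, by rw [length_tableZ] at h1; exact h1, ?_⟩
    rwa [List.getD_eq_getElem _ _ h1, List.getD_eq_getElem _ _ h2]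
  have hT := Λ.T_eq
  obtain ⟨hU', hY', hS', hA', -⟩ := offs_eq I Λ
  refine ⟨Λ.fin (Λ.oY + s), fun i j h => ?_, ?_⟩
  · rw [sblk_apply] at h
    have h1 := blk_lt i j
    have := Layout.fin_inj hΛ (by omega) (by omega) h
    omega
  · rwa [base_Y I hΛ R t uz _ hs, base_Y I hΛ R t uz _ hs, ytilOf_smul_gridPt I R t ht, ytilOf_smul_gridPt I R t ht]

/-! ### The label action of the stage is injective -/

/-- **The oracle action is an involution** (it XORs `f` of the query onto the answer zone, and the query
wires are not answer wires). [cite: NielsenChuang2010, §6.1.1] -/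
theorem oracleAct_oracleAct (f : (Fin Λ.kq → Bool) → (Fin (I.n * Λ.bc) → Bool)) (z : QReg W) :
    oracleAct Λ f (oracleAct Λ f z) = z := by
  classical
  have hT := Λ.T_eq
  obtain ⟨hU', hY', hS', hA', -⟩ := offs_eq I Λ
  have hkq : Λ.kq = Λ.Lq + I.n * Λ.ℓR := rfl
  have hLq := hΛ.Lq_le
  have hq : qry Λ (oracleAct Λ f z) = qry Λ z := by
    funext i
    have hi2 := i.2
    unfold qry
    by_cases hi : (i : ℕ) < Λ.Lq
    · rw [if_pos hi, if_pos hi, oracleAct_of_ne _ _ _ (fun j h => absurd (Layout.fin_inj hΛ (by omega) (by omega) h) (by omega))]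
    · rw [if_neg hi, if_neg hi, oracleAct_of_ne _ _ _ (fun j h => absurd (Layout.fin_inj hΛ (by omega) (by omega) h) (by omega))]
  funext w
  by_cases hw : ∃ j : Fin (I.n * Λ.bc), w = Λ.fin (Λ.oA + j)
  · obtain ⟨j, rfl⟩ := hw
    rw [oracleAct_answer hΛ, oracleAct_answer hΛ, hq, Bool.xor_assoc, Bool.xor_self, Bool.xor_false]
  · rw [oracleAct_of_ne _ _ _ (fun j hj => hw ⟨j, hj⟩), oracleAct_of_ne _ _ _ (fun j hj => hw ⟨j, hj⟩)]

/-- **The label action of the classical stage is injective**: the three blocks are programs of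
well-formed reversible operations and the oracle action is an involution. [cite: NielsenChuang2010, §3.2.5, §6.1.1] -/
theorem kappa_injective (hF : Fits Λ) (f : (Fin Λ.kq → Bool) → (Fin (I.n * Λ.bc) → Bool)) : Function.Injective (kappa Λ f) := by
  have hO : Function.Injective (oracleAct Λ f) := Function.LeftInverse.injective (g := oracleAct Λ f) (oracleAct_oracleAct I hΛ f)
  have hY : Function.Injective (clEval (opsY Λ)) := clEval_injective _ (CleanXor.ops_wf (geomY hΛ hF))
  have hS : Function.Injective (clEval (opsS Λ)) := clEval_injective _ (CleanXor.ops_wf (geomS hΛ hF))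
  have hX : Function.Injective (clEval (opsX Λ)) := clEval_injective _ (CleanXor.ops_wf (geomX hΛ hF))
  unfold kappa
  exact (((hO.comp hX).comp hO).comp hS).comp hY

/-- **The final labels are injective on the box** (the `lab_inj` register hypothesis). [folklore] -/
theorem kappa_lab₀_injOn [IsZLattice ℝ I.lattice] [NeZero R] (hF : Fits Λ) (ht : t ≠ 0) (f : (Fin Λ.kq → Bool) → (Fin (I.n * Λ.bc) → Bool)) :
    Set.InjOn (kappa Λ f ∘ lab₀ I Λ R t uz) (boxSet I.n Λ.ℓ (DT I R t) : Set (EuclideanSpace ℝ (Fin I.n))) :=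
  (kappa_injective I hΛ hF f).injOn.comp (lab₀_injOn I hΛ R t uz ht) (Set.mapsTo_univ _ _)

/-! ### List bookkeeping -/

omit hΛ in
/-- The query assembled from the prefix and the residue word, as a list. [folklore] -/
theorem ofFn_prefix (Fq wS : List Bool) (hFq : Fq.length = Λ.Lq) (hS : wS.length = I.n * Λ.ℓR) :
    List.ofFn (fun i : Fin Λ.kq => if (i : ℕ) < Λ.Lq then Fq.getD i false else wS.getD ((i : ℕ) - Λ.Lq) false) = Fq ++ wS := by
  have hkq : Λ.kq = Λ.Lq + I.n * Λ.ℓR := rfl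
  refine List.ext_getElem (by rw [List.length_ofFn, List.length_append, hFq, hS, hkq]) fun i h₁ h₂ => ?_
  rw [List.length_ofFn] at h₁
  rw [List.getElem_ofFn]
  show (if ((⟨i, h₁⟩ : Fin Λ.kq) : ℕ) < Λ.Lq then Fq.getD i false else wS.getD (i - Λ.Lq) false) = _
  by_cases hi : i < Λ.Lq
  · rw [if_pos hi, List.getElem_append_left (by rw [hFq]; exact hi), List.getD_eq_getElem _ _ (by rw [hFq]; exact hi)]
  · rw [if_neg hi, List.getElem_append_right (by rw [hFq]; omega), List.getD_eq_getElem _ _ (by rw [hS]; omega)]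
    simp only [hFq]

omit hΛ in
/-- A list is the list of its entries. [folklore] -/
theorem ofFn_getD (l : List Bool) {m : ℕ} (h : l.length = m) : List.ofFn (fun i : Fin m => l.getD (i : ℕ) false) = l := by
  subst h
  refine List.ext_getElem (by rw [List.length_ofFn]) fun i h₁ h₂ => ?_
  rw [List.getElem_ofFn, List.getD_eq_getElem _ _ h₂]

omit hΛ in
/-- Entry `(i, j)` of a residue table is bit `ℓ − 1 − j` of `sᵢ`. [folklore] -/
theorem getD_table (ℓ : ℕ) (s : Fin I.n → ℕ) (i : Fin I.n) (j : Fin ℓ) :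
    (table ℓ s).getD ((i : ℕ) * ℓ + j) false = (s i).testBit (ℓ - 1 - j) := by
  have hi : (i : ℕ) < (List.ofFn s).length := by rw [List.length_ofFn]; exact i.2
  have h1 := drop_take_tableL ℓ (List.ofFn s) hi
  rw [List.getElem_ofFn] at h1
  have h2 : (table ℓ s)[(i : ℕ) * ℓ + (j : ℕ)]? = (bitsMSBL ℓ (s i))[(j : ℕ)]? := by
    rw [← tableL_ofFn, ← h1, List.getElem?_take_of_lt j.2, List.getElem?_drop]
  rw [List.getD_eq_getElem?_getD, h2, List.getElem?_eq_getElem (by rw [bitsMSBL_eq]; unfold bitsMSB; rw [List.length_ofFn]; exact j.2),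
    Option.getD_some, getElem_bitsMSBL]

/-! ### Good points get the clean label of their branch -/

/-- **The `clean` register hypothesis.** Let the input zone hold `uz = F_q ++ ⟨⟨P_all⟩, e⟩ ++ pad` with `F_q`
the `CVP` query prefix of `(I, r, k, y, ℓR, bc)` (`|F_q| = Lq`, `|uz| = L`), let `1 ≤ ℓY`, `1 ≤ bc`, let the
branch vectors `ỹ` and the oracle's ideal answers `−m` of the box points fit their zones, and let
`√n/t ≤ λ₁(L*)/2`. Then on a GOOD box point `x = t • gridPt x̃` the ideal classical stage with the
`CVP` answer function ends in the clean label of the branch `y(x)` with the residues `s(x) = a(x̃) mod R`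
on the blocks: the point zone is erased, the answer zone is clean. [cite: Regev2009, Lemma 3.14 (proof)] -/
theorem kappa_lab₀_eq_labB [IsZLattice ℝ I.lattice] (hF : Fits Λ) {t : ℝ} (ht : 0 < t) (hℓY : 1 ≤ Λ.ℓY) (hbc : 1 ≤ Λ.bc)
    (hd : Real.sqrt I.n / t ≤ minNorm (dualLattice I.lattice) / 2)
    (r : ℚ) (k : ℕ) (y : List Bool) (e : ℚ) (Fq pad : List Bool)
    (hFq0 : Fq = boolPair (boolPair (stageInput (GapSVPInstance.encode (I, r)) (k + 1) y) (boolPair (encodeNat Λ.ℓR) (encodeNat Λ.bc))) [])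
    (hFq : Fq.length = Λ.Lq) (huz : (zoneOf Fq ((parOf I, 2 ^ Λ.ℓR), e) pad).length = Λ.L)
    (Yb : Fin I.n → Fin Λ.ℓ → Bool)
    (hyr : ∀ i, -2 ^ (Λ.ℓY - 1) ≤ ytil I (gridVec I Yb) i ∧ ytil I (gridVec I Yb) i < 2 ^ (Λ.ℓY - 1))
    (hmr : ∀ i, -2 ^ (Λ.bc - 1) ≤ -mVec I (2 ^ Λ.ℓR) (gridVec I Yb) i ∧ -mVec I (2 ^ Λ.ℓR) (gridVec I Yb) i < 2 ^ (Λ.bc - 1))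
    (hg : GoodT I (2 ^ Λ.ℓR) t ht.ne' (boxPt (DT I (2 ^ Λ.ℓR) t) Yb)) :
    kappa Λ (answerFn I r k y Λ.kq (I.n * Λ.bc))
        (lab₀ I Λ (2 ^ Λ.ℓR) t (zoneOf Fq ((parOf I, 2 ^ Λ.ℓR), e) pad) (boxPt (DT I (2 ^ Λ.ℓR) t) Yb)) =
      labB (Sblk I hΛ) (base I Λ (2 ^ Λ.ℓR) t (zoneOf Fq ((parOf I, 2 ^ Λ.ℓR), e) pad)) (enc I Λ)
        (yOfB (bRT I (2 ^ Λ.ℓR) t ht.ne') (boxPt (DT I (2 ^ Λ.ℓR) t) Yb))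
        (sOfB (bRT I (2 ^ Λ.ℓR) t ht.ne') (LamT I (2 ^ Λ.ℓR) t ht.ne') (eT I (2 ^ Λ.ℓR) t ht.ne') (2 ^ Λ.ℓR)
          (boxPt (DT I (2 ^ Λ.ℓR) t) Yb)) := by
  classical
  have hT := Λ.T_eq
  obtain ⟨hU', hY', hS', hA', -⟩ := offs_eq I Λ
  have hLq := hΛ.Lq_le
  have hR0 : 0 < 2 ^ Λ.ℓR := Nat.two_pow_pos _
  have hR1 : 1 ≤ 2 ^ Λ.ℓR := hR0
  have hD : DT I (2 ^ Λ.ℓR) t ≠ 0 := (DT_pos I (2 ^ Λ.ℓR) ht).ne'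
  have hx : boxPt (DT I (2 ^ Λ.ℓR) t) Yb = t • gridPt I (2 ^ Λ.ℓR) (gridVec I Yb) := boxPt_eq_smul_gridPt I (2 ^ Λ.ℓR) t Yb
  -- the words of the point register
  have hwY : wordY (parOf I) I.n Λ.ℓ Λ.ℓY (pointsWord Yb) = tableZ Λ.ℓY (ytil I (gridVec I Yb)) := wordY_points I Λ.ℓY Yb
  have hwS : wordS (parOf I) (2 ^ Λ.ℓR) I.n Λ.ℓ Λ.ℓR (pointsWord Yb) = table Λ.ℓR (sNat I (2 ^ Λ.ℓR) (gridVec I Yb)) :=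
    wordS_points I (2 ^ Λ.ℓR) hR1 Λ.ℓR Yb
  have hYlen : (wordY ((parOf I, 2 ^ Λ.ℓR), e).1.1 I.n Λ.ℓ Λ.ℓY (pointsWord Yb)).length = I.n * Λ.ℓY := by
    show (wordY (parOf I) I.n Λ.ℓ Λ.ℓY (pointsWord Yb)).length = _
    rw [hwY, length_tableZ]
  have hSlen : (wordS ((parOf I, 2 ^ Λ.ℓR), e).1.1 ((parOf I, 2 ^ Λ.ℓR), e).1.2 I.n Λ.ℓ Λ.ℓR (pointsWord Yb)).length = I.n * Λ.ℓR := by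
    show (wordS (parOf I) (2 ^ Λ.ℓR) I.n Λ.ℓ Λ.ℓR (pointsWord Yb)).length = _
    rw [hwS, CVPOracle.length_table]
  -- the initial label
  have hzX : ∀ s, s < I.n * Λ.ℓ → lab₀ I Λ (2 ^ Λ.ℓR) t (zoneOf Fq ((parOf I, 2 ^ Λ.ℓR), e) pad) (boxPt (DT I (2 ^ Λ.ℓR) t) Yb) (Λ.fin s) =
      (pointsWord Yb).getD s false := fun s hs => by
    rw [lab₀_X I hΛ _ t _ _ hs, blocksOf_boxPt I hD]
  obtain ⟨h1, h2, h3, h4, h5⟩ := kappa_spec hΛ hF (answerFn I r k y Λ.kq (I.n * Λ.bc)) ((parOf I, 2 ^ Λ.ℓR), e) (pointsWord Yb) Fq pad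
    (length_pointsWord Yb) hFq huz hYlen hSlen _ hzX (fun s hs => lab₀_U I hΛ _ t _ _ hs) (fun s hs hs' => lab₀_R I hΛ _ t _ _ hs hs')
    (fun w hw => lab₀_window I hΛ _ t _ _ w hw)
  -- the query and the ideal answer
  have hq : List.ofFn (fun i : Fin Λ.kq => if (i : ℕ) < Λ.Lq then Fq.getD i false else
      (wordS ((parOf I, 2 ^ Λ.ℓR), e).1.1 ((parOf I, 2 ^ Λ.ℓR), e).1.2 I.n Λ.ℓ Λ.ℓR (pointsWord Yb)).getD ((i : ℕ) - Λ.Lq) false) =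
      query I r k y (sNat I (2 ^ Λ.ℓR) (gridVec I Yb), Λ.ℓR, Λ.bc) := by
    rw [ofFn_prefix I Fq _ hFq hSlen, hFq0]
    exact prefix_append_wordS_eq_query I (2 ^ Λ.ℓR) hR1 Λ.ℓR Λ.bc Yb r k y
  have hfq : List.ofFn (answerFn I r k y Λ.kq (I.n * Λ.bc) (fun i : Fin Λ.kq => if (i : ℕ) < Λ.Lq then Fq.getD i false else
      (wordS ((parOf I, 2 ^ Λ.ℓR), e).1.1 ((parOf I, 2 ^ Λ.ℓR), e).1.2 I.n Λ.ℓ Λ.ℓR (pointsWord Yb)).getD ((i : ℕ) - Λ.Lq) false)) =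
      tableZ Λ.bc (fun j => -mVec I (2 ^ Λ.ℓR) (gridVec I Yb) j) := by
    rw [answerFn_of_ofFn_eq I r k y (I.n * Λ.bc) (inRange_sNat I hR0 le_rfl Λ.bc (gridVec I Yb)) hq,
      ofFn_getD _ (length_answerTable_sNat I (2 ^ Λ.ℓR) Λ.ℓR Λ.bc (gridVec I Yb))]
    exact answerTable_of_goodT I ht hd Λ.ℓR Λ.bc (gridVec I Yb) (hx ▸ hg)
  -- the erasing word is the point word
  have hwX : wordX ((parOf I, 2 ^ Λ.ℓR), e).1.1.1.2 ((parOf I, 2 ^ Λ.ℓR), e).1.1.2.2 ((parOf I, 2 ^ Λ.ℓR), e).1.2 I.n Λ.ℓ Λ.ℓY Λ.ℓR Λ.bc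
      (wordY ((parOf I, 2 ^ Λ.ℓR), e).1.1 I.n Λ.ℓ Λ.ℓY (pointsWord Yb) ++
        wordS ((parOf I, 2 ^ Λ.ℓR), e).1.1 ((parOf I, 2 ^ Λ.ℓR), e).1.2 I.n Λ.ℓ Λ.ℓR (pointsWord Yb) ++
        List.ofFn (answerFn I r k y Λ.kq (I.n * Λ.bc) (fun i : Fin Λ.kq => if (i : ℕ) < Λ.Lq then Fq.getD i false else
          (wordS ((parOf I, 2 ^ Λ.ℓR), e).1.1 ((parOf I, 2 ^ Λ.ℓR), e).1.2 I.n Λ.ℓ Λ.ℓR (pointsWord Yb)).getD ((i : ℕ) - Λ.Lq) false))) =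
      pointsWord Yb := by
    rw [hfq]
    show wordX (rows I.basis.transpose) I.basis.det.sign (2 ^ Λ.ℓR) I.n Λ.ℓ Λ.ℓY Λ.ℓR Λ.bc
      (wordY (parOf I) I.n Λ.ℓ Λ.ℓY (pointsWord Yb) ++ wordS (parOf I) (2 ^ Λ.ℓR) I.n Λ.ℓ Λ.ℓR (pointsWord Yb) ++
        tableZ Λ.bc (fun j => -mVec I (2 ^ Λ.ℓR) (gridVec I Yb) j)) = pointsWord Yb
    rw [hwY, hwS]
    exact wordX_points I (2 ^ Λ.ℓR) hℓY hbc hR0 le_rfl Yb _ hyr hmr fun j => by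
      rw [mul_neg, sub_neg_eq_add]; exact sNat_add_mul_mVec hR0 (gridVec I Yb) j
  -- branch and residues of the point
  have hyOf : yOfB (bRT I (2 ^ Λ.ℓR) t ht.ne') (boxPt (DT I (2 ^ Λ.ℓR) t) Yb) = t • gridPt I (2 ^ Λ.ℓR) (ytil I (gridVec I Yb)) := by
    rw [hx, yOfB_bRT_gridPt]
  have hsOf : sOfB (bRT I (2 ^ Λ.ℓR) t ht.ne') (LamT I (2 ^ Λ.ℓR) t ht.ne') (eT I (2 ^ Λ.ℓR) t ht.ne') (2 ^ Λ.ℓR) (boxPt (DT I (2 ^ Λ.ℓR) t) Yb) =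
      fun i => ((sNat I (2 ^ Λ.ℓR) (gridVec I Yb) i : ℕ) : ZMod (2 ^ Λ.ℓR)) := by
    rw [hx, sOfB_T_gridPt_eq_sNat]
  -- wire by wire
  funext w
  by_cases hSw : ∃ i j, w = Sblk I hΛ i j
  · -- a residue-block wire
    obtain ⟨i, j, rfl⟩ := hSw
    rw [labB, writeAll_apply_ws (sblk_disjoint I hΛ), sblk_apply, h3 _ (blk_lt i j), hsOf]
    show (wordS (parOf I) (2 ^ Λ.ℓR) I.n Λ.ℓ Λ.ℓR (pointsWord Yb)).getD ((i : ℕ) * Λ.ℓR + j) false = enc I Λ _ j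
    rw [hwS, getD_table, enc, ZMod.val_natCast, Nat.mod_eq_of_lt (sNat_lt hR0 _ i)]
  · have hSw' : ∀ i j, Sblk I hΛ i j ≠ w := fun i j h => hSw ⟨i, j, h.symm⟩
    rw [labB, writeAll_apply_of_forall_ne _ _ _ hSw']
    by_cases hXw : ∃ s, s < I.n * Λ.ℓ ∧ w = Λ.fin s
    · -- a point wire: erased
      obtain ⟨s, hs, rfl⟩ := hXw
      rw [h1 s hs, hwX, base_X I hΛ _ t _ _ hs, decide_getElem? _ (by rw [length_pointsWord]; exact hs),
        List.getD_eq_getElem _ _ (by rw [length_pointsWord]; exact hs), Bool.xor_self]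
    by_cases hRw : ∃ s, Λ.oY ≤ s ∧ s < Λ.T ∧ w = Λ.fin s
    · obtain ⟨s, hs, hs', rfl⟩ := hRw
      by_cases hsY : s < Λ.oS
      · -- a branch wire
        obtain ⟨s', rfl⟩ : ∃ s', s = Λ.oY + s' := ⟨s - Λ.oY, by omega⟩
        rw [h2 s' (by omega), base_Y I hΛ _ t _ _ (by omega), hyOf, ytilOf_smul_gridPt I _ t ht.ne']
        show (wordY (parOf I) I.n Λ.ℓ Λ.ℓY (pointsWord Yb)).getD s' false = _
        rw [hwY]
      by_cases hsA : s < Λ.oA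
      · -- a residue wire that is not a block wire: impossible
        exfalso
        have hℓR : 0 < Λ.ℓR := Nat.pos_of_ne_zero fun h0 => by rw [h0, Nat.mul_zero] at hA'; omega
        have hlt : (s - Λ.oS) / Λ.ℓR < I.n := Nat.div_lt_of_lt_mul (by rw [Nat.mul_comm]; omega)
        refine hSw ⟨⟨(s - Λ.oS) / Λ.ℓR, hlt⟩, ⟨(s - Λ.oS) % Λ.ℓR, Nat.mod_lt _ hℓR⟩, ?_⟩
        rw [sblk_apply]
        congr 1
        have := Nat.div_add_mod (s - Λ.oS) Λ.ℓR
        rw [Nat.mul_comm] at this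
        simp only
        omega
      · -- an answer wire: clean
        obtain ⟨j, rfl⟩ : ∃ j : Fin (I.n * Λ.bc), s = Λ.oA + j := ⟨⟨s - Λ.oA, by omega⟩, by simp only; omega⟩
        rw [h4 j, base_SA I hΛ _ t _ _ (by omega) hs']
    · -- any other wire: untouched, and `lab₀ = base` there
      have hX' : ∀ s, s < I.n * Λ.ℓ → w ≠ Λ.fin s := fun s hs h => hXw ⟨s, hs, h⟩
      have hR' : ∀ s, Λ.oY ≤ s → s < Λ.T → w ≠ Λ.fin s := fun s hs hs' h => hRw ⟨s, hs, hs', h⟩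
      rw [h5 w hX' hR']
      by_cases hUw : ∃ s, s < Λ.L ∧ w = Λ.fin (Λ.oU + s)
      · obtain ⟨s, hs, rfl⟩ := hUw
        rw [lab₀_U I hΛ _ t _ _ hs, base_U I hΛ _ t _ _ hs]
      · have hU'' : ∀ s, s < Λ.L → w ≠ Λ.fin (Λ.oU + s) := fun s hs h => hUw ⟨s, hs, h⟩
        rw [lab₀_off I _ t _ _ w hX' hU'', base_off I _ t _ _ w (fun s hs h => hR' (Λ.oY + s) (by omega) (by omega) h) hU'']

/-- **The register hypotheses of Regev's Lemma 3.14 hold for the sampler's classical stage with the ideal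
`CVP` answer function** (`QPart.RegHyps` for `κc = kappa Λ (answerFn …)`), in rescaled units with
`R = 2^{ℓR}`, under the fitting hypotheses of `kappa_lab₀_eq_labB` for all box points.
[cite: Regev2009, Lemma 3.14 (proof)] -/
theorem regHyps [IsZLattice ℝ I.lattice] (hF : Fits Λ) {t : ℝ} (ht : 0 < t) (hℓY : 1 ≤ Λ.ℓY) (hbc : 1 ≤ Λ.bc)
    (hd : Real.sqrt I.n / t ≤ minNorm (dualLattice I.lattice) / 2)
    (r : ℚ) (k : ℕ) (y : List Bool) (e : ℚ) (Fq pad : List Bool)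
    (hFq0 : Fq = boolPair (boolPair (stageInput (GapSVPInstance.encode (I, r)) (k + 1) y) (boolPair (encodeNat Λ.ℓR) (encodeNat Λ.bc))) [])
    (hFq : Fq.length = Λ.Lq) (huz : (zoneOf Fq ((parOf I, 2 ^ Λ.ℓR), e) pad).length = Λ.L)
    (hyr : ∀ (Yb : Fin I.n → Fin Λ.ℓ → Bool) i, -2 ^ (Λ.ℓY - 1) ≤ ytil I (gridVec I Yb) i ∧ ytil I (gridVec I Yb) i < 2 ^ (Λ.ℓY - 1))
    (hmr : ∀ (Yb : Fin I.n → Fin Λ.ℓ → Bool), GoodT I (2 ^ Λ.ℓR) t ht.ne' (boxPt (DT I (2 ^ Λ.ℓR) t) Yb) →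
      ∀ i, -2 ^ (Λ.bc - 1) ≤ -mVec I (2 ^ Λ.ℓR) (gridVec I Yb) i ∧ -mVec I (2 ^ Λ.ℓR) (gridVec I Yb) i < 2 ^ (Λ.bc - 1)) :
    RegHyps (Sblk I hΛ) (base I Λ (2 ^ Λ.ℓR) t (zoneOf Fq ((parOf I, 2 ^ Λ.ℓR), e) pad)) (enc I Λ)
      (boxSet I.n Λ.ℓ (DT I (2 ^ Λ.ℓR) t)) (yOfB (bRT I (2 ^ Λ.ℓR) t ht.ne'))
      (sOfB (bRT I (2 ^ Λ.ℓR) t ht.ne') (LamT I (2 ^ Λ.ℓR) t ht.ne') (eT I (2 ^ Λ.ℓR) t ht.ne') (2 ^ Λ.ℓR))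
      (GoodT I (2 ^ Λ.ℓR) t ht.ne') (lab₀ I Λ (2 ^ Λ.ℓR) t (zoneOf Fq ((parOf I, 2 ^ Λ.ℓR), e) pad))
      (kappa Λ (answerFn I r k y Λ.kq (I.n * Λ.bc))) where
  lab_inj := kappa_lab₀_injOn I hΛ (2 ^ Λ.ℓR) t _ hF ht.ne' _
  clean x hx hgx := by
    obtain ⟨Yb, -, rfl⟩ := mem_image.1 hx
    exact kappa_lab₀_eq_labB I hΛ hF ht hℓY hbc hd r k y e Fq pad hFq0 hFq huz Yb (hyr Yb) (hmr Yb hgx) hgx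
  base_sep x hx x' hx' hne := by
    obtain ⟨Yb, -, rfl⟩ := mem_image.1 hx
    obtain ⟨Yb', -, rfl⟩ := mem_image.1 hx'
    rw [boxPt_eq_smul_gridPt I (2 ^ Λ.ℓR) t Yb, boxPt_eq_smul_gridPt I (2 ^ Λ.ℓR) t Yb', yOfB_bRT_gridPt, yOfB_bRT_gridPt] at hne ⊢
    exact base_sep I hΛ (2 ^ Λ.ℓR) t _ ht.ne' hℓY (hyr Yb) (hyr Yb') hne
  hdis := sblk_disjoint I hΛ
  enc_val := valBE_enc I

end SamplerRegs

end Regev2009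

end Literature.Computability.Cryptography

end
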